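import Summits.CriticalPhenomena.PercolationContinuityZ3.Theorems.Transplant.SkelConcExcess
import Summits.CriticalPhenomena.PercolationContinuityZ3.Theorems.Transplant.SkelHabLevels
import HarnessLib

/-!
# L6 (C) under the Ω-route (p3-g4 ruling 20:22:53Z): the rim excess of a subbox weighting of a HABITAT-RESTRICTED window graph
# `Skel.winGraphIn G Ω` — twins of hp-8 g24's `Skel.real_excess_eq` / `real_rim_le_excess` / `real_rim_le_of_radius` (SkelConcExcess, p232268)
# with `winGraph G w₁ Rπ`, `D ⊆ B_G(w₁, Rπ)` replaced by `winGraphIn G Ω`, `D ⊆ Ω` (transfer by p2-g4's `real_eq_of_determinedBy_winIn`, p235203)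

builds on p205010 (kernel theorem, internal audit signed; external expert review pending) — nothing in this file uses p205010.
Lane `prim-bschramm`, seat `prim-bschramm-p5` (gen 4; holder of the (C) port), helper file (`--supports stmt-CriticalPhenomena-4575`).
The corridor chain of residue (C) lives in `winGraphIn G Ucor` (the seam obstruction of 20:05Z/20:16Z and its cure); its rim-excess clause
`P_{Wcor}(⋃_{t ∈ Rim i} root ↔ t) ≤ η` is discharged by `real_rim_le_of_radius_In` below from the centre-uniform excess radius
(`Skel.exists_excess_radius_uniform`, unchanged) and the deep entrances along runs (`Skel.deep_of_run`, p234850).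
[cite: KozmaNitzan2024, §4 Lemma 12 (p. 24: the faces on the boundary of the slab)] [cite: MartineauSevero2019, Cor. 2.2]
-/

noncomputable section

open MeasureTheory

namespace Summit.CriticalPhenomena.PercolationContinuityZ3.Theorems

namespace Transplant

namespace Skel

open Literature.Probability.Percolation Literature.Probability.LatticeModels SimpleGraph KNLevels
open Literature.Probability.Percolation.GM
open Literature.Barriers.CriticalPhenomena (graphBall graphBall_finite mem_graphBall_self graphBall_mono)
open KozmaNitzan (wireSet_mono)

open scoped Classical

variable {V : Type}

section Free

variable (G : SimpleGraph V) [G.LocallyFinite]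

/-- **The excess probability under a subbox weighting of a habitat-restricted window graph** equals the `P_q` one on `G` (the event is
determined by the pairs inside `D ⊆ Ω`). [folklore] -/
theorem real_excess_eq_In [Countable V] {Ω : Finset V} {Wt : Sym2 V → unitInterval} {q : unitInterval} {D : Finset V}
    (hWD : IsSubbox (winGraphIn G Ω) Wt q D) (hDΩ : D ⊆ Ω) (w₀ : V) (R : ℕ) (A : Finset V) :
    (prodBernoulli Wt).real (excess G w₀ R D A) = (bondPercolation G q).real (excess G w₀ R D A) := by
  rw [hWD.real_eq_bondPercolation (determinedBy_excess G w₀ R D A) (measurableSet_excess G w₀ R D A)]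
  exact real_eq_of_determinedBy_winIn (G := G) q
    ((determinedBy_excess G w₀ R D A).mono (wireSet_mono fun v hv => Finset.mem_coe.2 (hDΩ (Finset.mem_coe.1 hv))))
    (measurableSet_excess G w₀ R D A)

/-- **Rim excess ≤ excess probability** (habitat-restricted window graph): as `Skel.real_rim_le_excess` with `winGraphIn G Ω`, `D ⊆ Ω`.
[cite: KozmaNitzan2024, §4 Lemma 12 (p. 24)] -/
theorem real_rim_le_excess_In [Countable V] {Ω : Finset V} {Wt : Sym2 V → unitInterval} {q : unitInterval} {D : Finset V}
    (hWD : IsSubbox (winGraphIn G Ω) Wt q D) (hDΩ : D ⊆ Ω) (hWG : ∀ e, e ∉ G.edgeSet → Wt e = 0)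
    {root : V} (hroot : root ∉ D) {w₀ : V} {R L' R₀' : ℕ} {Rim : Finset V} (hRimD : Rim ⊆ D)
    (hRimfar : ∀ t ∈ Rim, t ∉ graphBall G w₀ (R - L'))
    (hA : ∀ a b, a ∉ D → b ∈ D → G.Adj a b → Wt s(a, b) ≠ 0 → b ∈ graphBall G w₀ R₀') :
    (prodBernoulli Wt).real (⋃ t ∈ Rim, openConn root t) ≤
      (bondPercolation G q).real (excess G w₀ (R - L') D (D.filter fun v => v ∈ graphBall G w₀ R₀')) := by
  set A := D.filter fun v => v ∈ graphBall G w₀ R₀' with hAdef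
  have h1 := real_biUnion_openConn_le_linkIn (G := G) hWG hRimD hroot (A := A)
    (fun a b ha hb hab hw => Finset.mem_filter.2 ⟨hb, hA a b ha hb hab hw⟩)
  have h2 : linkIn (↑D : Set V) A Rim ⊆ excess G w₀ (R - L') D A := by
    rw [excess]
    exact linkIn_mono le_rfl le_rfl fun t ht => Finset.mem_filter.2 ⟨hRimD ht, hRimfar t ht⟩
  calc (prodBernoulli Wt).real (⋃ t ∈ Rim, openConn root t)
      ≤ (prodBernoulli Wt).real (linkIn (↑D : Set V) A Rim) := h1
    _ ≤ (prodBernoulli Wt).real (excess G w₀ (R - L') D A) := measureReal_mono h2 (measure_ne_top _ _)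
    _ = (bondPercolation G q).real (excess G w₀ (R - L') D A) := real_excess_eq_In G hWD hDΩ w₀ (R - L') A

end Free

/-! ## §2 The discharge from a centre-uniform excess radius -/

variable {G : SimpleGraph V} [G.LocallyFinite] (Φ : PlanarSkeletonConc G)

/-- **Rim excess ≤ η in a habitat-restricted window graph** from an excess radius at the running parameter (the conclusion of
`Skel.exists_excess_radius_uniform` at `q`), `R₁ ≤ R − L'`, the habitat inside `B_G(w₀, R_w)` and of planar diameter `≤ m` — the (C)
chain's rim clause under the Ω-route. [cite: KozmaNitzan2024, §4 Lemma 12 (p. 24)] [cite: MartineauSevero2019, Cor. 2.2] -/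
theorem real_rim_le_of_radius_In [Countable V] {Ω : Finset V} {Wt : Sym2 V → unitInterval} {q : unitInterval} {D : Finset V}
    (hWD : IsSubbox (winGraphIn G Ω) Wt q D) (hDΩ : D ⊆ Ω) (hWG : ∀ e, e ∉ G.edgeSet → Wt e = 0)
    {root : V} (hroot : root ∉ D) {w₀ : V} {R L' R₀' : ℕ} {Rim : Finset V} (hRimD : Rim ⊆ D)
    (hRimfar : ∀ t ∈ Rim, t ∉ graphBall G w₀ (R - L'))
    (hA : ∀ a b, a ∉ D → b ∈ D → G.Adj a b → Wt s(a, b) ≠ 0 → b ∈ graphBall G w₀ R₀')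
    {m : ℕ} {η : ℝ} {R₁ : ℕ}
    (hR₁ : ∀ R', R₁ ≤ R' → ∀ (Rw : ℕ) (D' A' : Finset V), (∀ d ∈ D', d ∈ graphBall G w₀ Rw) →
      (∀ d ∈ D', ∀ d' ∈ D', Φ.φ d - Φ.φ d' ∈ box 2 m) → A' ⊆ D' → (∀ a ∈ A', a ∈ graphBall G w₀ R₀') →
        (bondPercolation G q).real (excess G w₀ R' D' A') ≤ η)
    (hR : R₁ ≤ R - L') {Rw : ℕ} (hDw : ∀ d ∈ D, d ∈ graphBall G w₀ Rw) (hDm : ∀ d ∈ D, ∀ d' ∈ D, Φ.φ d - Φ.φ d' ∈ box 2 m) :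
    (prodBernoulli Wt).real (⋃ t ∈ Rim, openConn root t) ≤ η := by
  refine (real_rim_le_excess_In G hWD hDΩ hWG hroot hRimD hRimfar hA).trans ?_
  exact hR₁ _ hR Rw D _ hDw hDm (Finset.filter_subset _ _) fun a ha => (Finset.mem_filter.1 ha).2

end Skel

end Transplant

end Summit.CriticalPhenomena.PercolationContinuityZ3.Theorems

end
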